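import Literature.NumberTheory.GaloisRepresentations.ExplicitMuCocyclesBridge
import Literature.NumberTheory.GaloisRepresentations.LocalBrauerRestrictionDegree
import Literature.NumberTheory.GaloisRepresentations.LocalCorInjective
import Literature.NumberTheory.GaloisRepresentations.NeukirchAbstractUniqueness
import HarnessLib

/-!
# The local axioms of Neukirch's lemma for `Gal(F̄/E)`, `E` finite over a local field `F`

Topic `NumberTheory/GaloisRepresentations`; namespace
`Literature.NumberTheory.GaloisRepresentations.ExplicitMuCocycles`.  Proof file: theorems only (no
definition, no instance, no named fact).

For a non-archimedean local field `F` of characteristic `0`, a prime `ℓ`, finite extensions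
`E ⊆ L` of `F` inside `F̄` with absolute Galois groups `Γ_E = galFixing F E ⊇ Γ_L = galFixing F L`
(subgroup model), `Γ_E` acting trivially on `μ_ℓ(F̄)` (i.e. `ζ_ℓ ∈ E`), and an identification
`e : ℤ/ℓ ≃ μ_ℓ(F̄)`, the three LOCAL hypotheses (AxLn), (AxD), (AxLv), (AxLi) of the abstract
Neukirch lemma (`NeukirchAbstractContainment.lean`) hold in the explicit-cochain language
(`ℤ/ℓ`-valued locally constant `2`-cocycles on the subgroup, `ExplicitMuCocyclesBridge.lean`):

* `exists_explicit_not_coboundary` — `H²(Γ_E, ℤ/ℓ) ≠ 0` and `exists_sub_mul_coboundary` — every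
  class is a multiple of a non-zero one; both from `|H²(Γ_E, μ_ℓ)| = ℓ` (the tree's
  `natCard_two_mu_eq`, Serre *Corps locaux* XIII §3);
* `coboundary_of_dvd_relIndex` — restriction to `Γ_L` kills every class when `ℓ ∣ [L : E]`
  (the tree's `resSub_two_mu_eq_zero_of_dvd_relIndex`, Serre XIII §3 Prop. 7);
* `coboundary_of_coboundary_of_not_dvd_relIndex` — restriction to `Γ_L` is injective when
  `ℓ ∤ [L : E]` (`Cor ∘ Res = [L : E]`, the tree's `eq_zero_of_resH_eq_zero_of_psmul_eq_zero`,
  Serre *Cohomologie galoisienne* I §2.4).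

Written for the number-field instantiation of [NSW] (12.1.9) (abc-iut GAP-LEDGER G-L4d2g4-1,
campaign L); classical, nothing here bears on [IUTchIII] Cor. 3.12.

## References

* J.-P. Serre, *Corps locaux* (1968), XIII §3. [SerreLocalFields1979]
* J.-P. Serre, *Galois Cohomology* (1997), I §2.4, II §5. [SerreGaloisCohomology1997]
* J. Neukirch, A. Schmidt, K. Wingberg, *Cohomology of Number Fields* (2008), (7.1.8), (12.1.9).
  [NeukirchSchmidtWingberg2008]
-/

noncomputable section

open CategoryTheory Function

universe u

namespace Literature.NumberTheory.GaloisRepresentations.ExplicitMuCocycles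

open Literature.NumberTheory.GaloisRepresentations
open Literature.NumberTheory.GaloisRepresentations.NeukirchAbstract
open Literature.GroupTheory.LocallyConstantCocycles
open _root_.TopRep _root_.ContRepresentation _root_.ContinuousCohomology Field DiscreteGaloisModule
  LocalWeilDatum

variable (F : Type u) [Field F] [ValuativeRel F] [TopologicalSpace F] [IsNonarchimedeanLocalField F]
  [CharZero F]
variable {ℓ : ℕ} [hℓ : Fact ℓ.Prime]
omit [ValuativeRel F] [TopologicalSpace F] [IsNonarchimedeanLocalField F] hℓ in
/-- `μ_n(F̄) ≅ ℤ/n` as abstract groups (`F` of characteristic `0`): the roots of unity of the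
algebraically closed field `F̄` form a cyclic group of order `n`. [cite: SerreGaloisCohomology1997, II §1.2] -/
theorem nonempty_addEquiv_zmod_muCarrier (n : ℕ) [NeZero n] : Nonempty (ZMod n ≃+ MuCarrier F n) := by
  haveI : NeZero (n : F) := NeZero.charZero
  have hcyc : IsAddCyclic (MuCarrier F n) :=
    isAddCyclic_additive_iff.2 (inferInstance : IsCyclic (rootsOfUnity n (AlgebraicClosure F)))
  have hcard : Nat.card (MuCarrier F n) = n :=
    HasEnoughRootsOfUnity.natCard_rootsOfUnity (AlgebraicClosure F) n
  exact ⟨(ZMod.ringEquivCongr hcard).symm.toAddEquiv.trans (zmodAddCyclicAddEquiv hcyc)⟩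

variable (E : IntermediateField F (AlgebraicClosure F)) [FiniteDimensional F E]
variable (hE : ∀ σ ∈ galFixing F E, ∀ z : MuCarrier F ℓ, mu F ℓ σ z = z)

include hE

/-- **(AxLn) `H²(Γ_E, ℤ/ℓ) ≠ 0`, explicit form**: there is a `ℤ/ℓ`-valued locally constant
`2`-cocycle on `Γ_E = galFixing F E` which is not a coboundary (`|H²(Γ_E, μ_ℓ)| = ℓ > 1`).
[cite: SerreLocalFields1979, XIII §3] -/
theorem exists_explicit_not_coboundary :
    ∃ f : absoluteGaloisGroup F → absoluteGaloisGroup F → ZMod ℓ,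
      IsLocallyConstant (fun q : galFixing F E × galFixing F E => f q.1 q.2) ∧
      (∀ a ∈ galFixing F E, ∀ b ∈ galFixing F E, ∀ c ∈ galFixing F E,
        f a b + f (a * b) c = f b c + f a (b * c)) ∧
      ¬ ∃ β : absoluteGaloisGroup F → ZMod ℓ, IsLocallyConstant (fun s : galFixing F E => β s) ∧
        ∀ a ∈ galFixing F E, ∀ b ∈ galFixing F E, f a b = β a + β b - β (a * b) := by
  haveI : IsClosed ((galFixing F E : Subgroup (absoluteGaloisGroup F)) : Set (absoluteGaloisGroup F)) :=
    isClosed_galFixing' F E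
  haveI : NeZero ℓ := ⟨hℓ.out.ne_zero⟩
  obtain ⟨e⟩ := nonempty_addEquiv_zmod_muCarrier F ℓ
  have hcard := natCard_two_mu_eq F E ℓ
  haveI : Finite (continuousCohomology 2 ((mu F ℓ).restrict (subgroupIncl (galFixing F E))).toTopRep) :=
    finite_two_mu F E ℓ
  -- a non-zero class
  obtain ⟨z, hz⟩ : ∃ z : continuousCohomology 2 ((mu F ℓ).restrict (subgroupIncl (galFixing F E))).toTopRep,
      z ≠ 0 := by
    have h1 : 1 < Nat.card (continuousCohomology 2
        ((mu F ℓ).restrict (subgroupIncl (galFixing F E))).toTopRep) := by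
      rw [hcard]; exact hℓ.out.one_lt
    obtain ⟨a, b, hab⟩ := (Finite.one_lt_card_iff_nontrivial.1 h1).exists_pair_ne
    by_cases ha : a = 0
    · exact ⟨b, fun hb => hab (ha.trans hb.symm)⟩
    · exact ⟨a, ha⟩
  obtain ⟨c, rfl⟩ := twoCocycleClass_surjective _ z
  obtain ⟨f, hflc, hfcoc, hcf⟩ := exists_explicit_of_contTwoCocycle (galFixing F E) e hE c
  refine ⟨f, hflc, hfcoc, fun hcob => hz ?_⟩
  exact (twoCocycleClass_eq_zero_iff_explicit (galFixing F E) e hE f c hcf).2 hcob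

/-- **(AxD) local dimension `≤ 1`, explicit form**: if `f` is a non-bounding explicit cocycle on
`Γ_E` then every explicit cocycle `g` satisfies `g - c f ∼ 0` for some `c ∈ ℤ/ℓ` (`H²(Γ_E, μ_ℓ)` has
prime order `ℓ`, so `[f]` generates it). [cite: SerreLocalFields1979, XIII §3] -/
theorem exists_sub_mul_coboundary (f g : absoluteGaloisGroup F → absoluteGaloisGroup F → ZMod ℓ)
    (hflc : IsLocallyConstant (fun q : galFixing F E × galFixing F E => f q.1 q.2))
    (hfcoc : ∀ a ∈ galFixing F E, ∀ b ∈ galFixing F E, ∀ c ∈ galFixing F E,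
      f a b + f (a * b) c = f b c + f a (b * c))
    (hglc : IsLocallyConstant (fun q : galFixing F E × galFixing F E => g q.1 q.2))
    (hgcoc : ∀ a ∈ galFixing F E, ∀ b ∈ galFixing F E, ∀ c ∈ galFixing F E,
      g a b + g (a * b) c = g b c + g a (b * c))
    (hf : ¬ ∃ β : absoluteGaloisGroup F → ZMod ℓ, IsLocallyConstant (fun s : galFixing F E => β s) ∧
      ∀ a ∈ galFixing F E, ∀ b ∈ galFixing F E, f a b = β a + β b - β (a * b)) :
    ∃ c : ZMod ℓ, ∃ β : absoluteGaloisGroup F → ZMod ℓ,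
      IsLocallyConstant (fun s : galFixing F E => β s) ∧
      ∀ a ∈ galFixing F E, ∀ b ∈ galFixing F E, (g a b - c * f a b) = β a + β b - β (a * b) := by
  haveI : IsClosed ((galFixing F E : Subgroup (absoluteGaloisGroup F)) : Set (absoluteGaloisGroup F)) :=
    isClosed_galFixing' F E
  haveI : NeZero ℓ := ⟨hℓ.out.ne_zero⟩
  obtain ⟨e⟩ := nonempty_addEquiv_zmod_muCarrier F ℓ
  have hcard := natCard_two_mu_eq F E ℓ
  obtain ⟨cf, hcf⟩ := exists_contTwoCocycle (galFixing F E) e hE f hflc hfcoc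
  obtain ⟨cg, hcg⟩ := exists_contTwoCocycle (galFixing F E) e hE g hglc hgcoc
  have hne : twoCocycleClass _ cf ≠ 0 := fun h =>
    hf ((twoCocycleClass_eq_zero_iff_explicit (galFixing F E) e hE f cf hcf).1 h)
  -- `[cg]` is a natural multiple of `[cf]`
  have hmem := mem_multiples_of_prime_card hcard (g' := twoCocycleClass _ cg) hne
  obtain ⟨k, hk⟩ := (AddSubmonoid.mem_multiples_iff _ _).1 hmem
  refine ⟨(k : ZMod ℓ), ?_⟩
  have hzero : twoCocycleClass _ (cg - k • cf) = 0 := by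
    rw [twoCocycleClass_sub, ← twoCocycleClassₗ_apply _ (k • cf), map_nsmul, twoCocycleClassₗ_apply]
    exact sub_eq_zero.2 hk.symm
  exact (twoCocycleClass_eq_zero_iff_explicit (galFixing F E) e hE _ (cg - k • cf)
    (contTwoCocycle_sub_nsmul (galFixing F E) e f g cf cg hcf hcg k)).1 hzero

variable (L : IntermediateField F (AlgebraicClosure F)) [FiniteDimensional F L] (hEL : E ≤ L)

include hEL

/-- **(AxLv) restriction kills `H²` in degree divisible by `ℓ`, explicit form**: if
`ℓ ∣ [Γ_E : Γ_L] = [L : E]`, every explicit cocycle on `Γ_E` bounds on `Γ_L`.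
[cite: SerreLocalFields1979, XIII §3 Prop. 7] -/
theorem coboundary_of_dvd_relIndex (hnd : ℓ ∣ (galFixing F L).relIndex (galFixing F E))
    (f : absoluteGaloisGroup F → absoluteGaloisGroup F → ZMod ℓ)
    (hflc : IsLocallyConstant (fun q : galFixing F E × galFixing F E => f q.1 q.2))
    (hfcoc : ∀ a ∈ galFixing F E, ∀ b ∈ galFixing F E, ∀ c ∈ galFixing F E,
      f a b + f (a * b) c = f b c + f a (b * c)) :
    ∃ β : absoluteGaloisGroup F → ZMod ℓ, IsLocallyConstant (fun s : galFixing F L => β s) ∧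
      ∀ a ∈ galFixing F L, ∀ b ∈ galFixing F L, f a b = β a + β b - β (a * b) := by
  haveI : IsClosed ((galFixing F E : Subgroup (absoluteGaloisGroup F)) : Set (absoluteGaloisGroup F)) :=
    isClosed_galFixing' F E
  haveI : IsClosed ((galFixing F L : Subgroup (absoluteGaloisGroup F)) : Set (absoluteGaloisGroup F)) :=
    isClosed_galFixing' F L
  haveI : NeZero ℓ := ⟨hℓ.out.ne_zero⟩
  obtain ⟨e⟩ := nonempty_addEquiv_zmod_muCarrier F ℓ
  have h : galFixing F L ≤ galFixing F E := galFixing_antitone F hEL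
  have hL : ∀ σ ∈ galFixing F L, ∀ z : MuCarrier F ℓ, mu F ℓ σ z = z := fun σ hσ => hE σ (h hσ)
  obtain ⟨c, hc⟩ := exists_contTwoCocycle (galFixing F E) e hE f hflc hfcoc
  obtain ⟨c', hc'⟩ := exists_contTwoCocycle (galFixing F L) e hL f (lc₂_mono h hflc) (coc_mono h hfcoc)
  have hres := resSub_two_mu_eq_zero_of_dvd_relIndex F E L hEL hℓ.out.pos hnd (twoCocycleClass _ c)
  rw [resSub_twoCocycleClass_explicit (galFixing F E) e h f c hc c' hc'] at hres
  exact (twoCocycleClass_eq_zero_iff_explicit (galFixing F L) e hL f c' hc').1 hres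

omit [ValuativeRel F] [TopologicalSpace F] [IsNonarchimedeanLocalField F] [FiniteDimensional F E] in
/-- **(AxLi) restriction is injective in degree prime to `ℓ`, explicit form**: if
`ℓ ∤ [Γ_E : Γ_L]` and an explicit cocycle on `Γ_E` bounds on `Γ_L`, it bounds on `Γ_E`
(`Cor ∘ Res = [L : E]` and the class is `ℓ`-torsion). [cite: SerreGaloisCohomology1997, I §2.4 Prop. 9] -/
theorem coboundary_of_coboundary_of_not_dvd_relIndex
    (hnd : ¬ ℓ ∣ (galFixing F L).relIndex (galFixing F E))
    (f : absoluteGaloisGroup F → absoluteGaloisGroup F → ZMod ℓ)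
    (hflc : IsLocallyConstant (fun q : galFixing F E × galFixing F E => f q.1 q.2))
    (hfcoc : ∀ a ∈ galFixing F E, ∀ b ∈ galFixing F E, ∀ c ∈ galFixing F E,
      f a b + f (a * b) c = f b c + f a (b * c))
    (hcob : ∃ β : absoluteGaloisGroup F → ZMod ℓ, IsLocallyConstant (fun s : galFixing F L => β s) ∧
      ∀ a ∈ galFixing F L, ∀ b ∈ galFixing F L, f a b = β a + β b - β (a * b)) :
    ∃ β : absoluteGaloisGroup F → ZMod ℓ, IsLocallyConstant (fun s : galFixing F E => β s) ∧
      ∀ a ∈ galFixing F E, ∀ b ∈ galFixing F E, f a b = β a + β b - β (a * b) := by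
  haveI : IsClosed ((galFixing F E : Subgroup (absoluteGaloisGroup F)) : Set (absoluteGaloisGroup F)) :=
    isClosed_galFixing' F E
  haveI : CompactSpace (galFixing F E) := compactSpace_of_isClosed_subgroup
  haveI : NeZero ℓ := ⟨hℓ.out.ne_zero⟩
  obtain ⟨e⟩ := nonempty_addEquiv_zmod_muCarrier F ℓ
  have h : galFixing F L ≤ galFixing F E := galFixing_antitone F hEL
  -- the subgroup `T' = Γ_L` of the subtype `↥Γ_E` and its image `U' = Γ_L` in `Γ_F`
  set S := galFixing F E with hSdef
  set T' : Subgroup S := (galFixing F L).subgroupOf S with hT'def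
  have hU'eq : T'.map S.subtype = galFixing F L := by
    rw [hT'def, Subgroup.subgroupOf_map_subtype, inf_eq_left.2 h]
  haveI : IsClosed (((T'.map S.subtype : Subgroup (absoluteGaloisGroup F))) : Set (absoluteGaloisGroup F)) := by
    rw [hU'eq]; exact isClosed_galFixing' F L
  have hU'le : T'.map S.subtype ≤ galFixing F L := hU'eq.le
  have hU' : ∀ σ ∈ T'.map S.subtype, ∀ z : MuCarrier F ℓ, mu F ℓ σ z = z :=
    fun σ hσ => hE σ (h (hU'le hσ))
  obtain ⟨c, hc⟩ := exists_contTwoCocycle (galFixing F E) e hE f hflc hfcoc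
  obtain ⟨c', hc'⟩ := exists_contTwoCocycle (T'.map S.subtype) e hU' f
    (lc₂_mono (hU'le.trans h) hflc) (coc_mono (hU'le.trans h) hfcoc)
  -- the class restricted to `U'` vanishes
  have hres : resSub (mu F ℓ) (map_subtype_le' T') 2 (twoCocycleClass _ c) = 0 := by
    rw [resSub_twoCocycleClass_explicit (galFixing F E) e (map_subtype_le' T') f c hc c' hc']
    exact (twoCocycleClass_eq_zero_iff_explicit (T'.map S.subtype) e hU' f c' hc').2
      (coboundary_mono hU'le hcob)
  have hresH := (resSub_eq_zero_iff_resH_eq_zero (mu F ℓ) T' 2 (twoCocycleClass _ c)).1 hres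
  -- `T'` is open of index prime to `ℓ`, and the class is `ℓ`-torsion
  have hT'open : IsOpen (T' : Set S) := by
    rw [hT'def]
    exact (isOpen_galFixing F L).preimage continuous_subtype_val
  have hidx : T'.index = (galFixing F L).relIndex (galFixing F E) := rfl
  have hcop : T'.index.Coprime ℓ := by
    rw [hidx]
    exact (Nat.Prime.coprime_iff_not_dvd hℓ.out).2 hnd |>.symm
  have htors : (ℓ ^ 1) • twoCocycleClass _ c = 0 := by
    rw [pow_one, ← twoCocycleClassₗ_apply, ← map_nsmul, twoCocycleClassₗ_apply]
    have : ℓ • c = 0 := by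
      refine Subtype.ext (ContinuousMap.ext fun q => ?_)
      obtain ⟨s, t⟩ := q
      change ℓ • c.1 (s, t) = 0
      rw [hc, ← map_nsmul, nsmul_eq_mul, ZMod.natCast_self, zero_mul, map_zero]
    rw [this, twoCocycleClass_zero]
  have hz := eq_zero_of_resH_eq_zero_of_psmul_eq_zero ((mu F ℓ).restrict (subgroupIncl S)) T' hT'open
    hcop (twoCocycleClass _ c) hresH htors
  exact (twoCocycleClass_eq_zero_iff_explicit (galFixing F E) e hE f c hc).1 hz

end Literature.NumberTheory.GaloisRepresentations.ExplicitMuCocycles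

end
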